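import Summits.ABC.ABC.Theses.CubicResolventAllowance
import Summits.ABC.ABC.Theorems.CubicResolventAllowanceResolventDiscBounds
import Summits.ABC.ABC.Theorems.NumberFieldRamificationDiscr
import Literature.NumberTheory.NumberFields.UnramifiedCubicResolventDiscriminant
import Literature.NumberTheory.CubicFields.HasseUnramifiedResolvent
import Literature.NumberTheory.NumberFields.HilbertClassFieldMaximal
import Literature.NumberTheory.QuadraticFields.FundamentalDiscriminant
import HarnessLib

/-!
# STUB-IDEAS `stub_realCubic` — ideator k2, generation 10 (HOME FAMILY 2 — RESHAPE): companion sketch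

Crux `stmt-ABC-22740` (`IndexSzpiro`), stub `stub_realCubic` (the `0 < d_K` half).  Statements only
(helper lemmas `R0 … R6`, each sized for one prover cycle; `sorry` marks what is NOT proved here);
the two glue theorems `stub_of_sqfSzpiro` / `sqfSzpiroOn_sector_of_stub` are the assembly sketch.
Plan text: `Cruxes/IndexSzpiro/STUB-IDEAS-stub_realCubic-2.md` (gen 10).

RESHAPE (Hasse class field theory).  For a cubic field `K` with quadratic resolvent `K₂ = ℚ(√d_K)`,
`d_K = d_{K₂} · f²` where `f` is the product of the primes TOTALLY ramified in `K` (Hasse 1930).  On the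
elliptic side `K₂ = ℚ(√Δ_min)` and, on the semistable sector, no prime is totally ramified in `K` except
possibly `2` (good supersingular reduction at `2`).  Hence on that sector the allowance `|d_K|` is the
FUNDAMENTAL DISCRIMINANT of `ℚ(√Δ_min)` (times `4` in the `2`-supersingular escape): the stub there is the
`K`-free, `r`-free inequality `Δ_min ≤ C · sqf(Δ_min) · N^{6+ε}` (`SqfSzpiroOn`), and the whole content of the
existence hypothesis `r = 0` is `3 ∣ h(ℚ(√Δ_min))` (`ResidueR0`).
-/

set_option linter.dupNamespace false
set_option backward.isDefEq.respectTransparency false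

noncomputable section

open scoped NumberField
open NumberField IsDedekindDomain Ideal Polynomial WeierstrassCurve Module IntermediateField

namespace Summit.ABC.ABC.Cruxes.IndexSzpiro.StubIdeas2RealG10

open Summit.ABC.ABC.Theses.CubicResolventAllowance Summit.ABC.ABC.Theorems
open Literature.NumberTheory.NumberFields Literature.NumberTheory.CubicFields
open Literature.NumberTheory.QuadraticFields

/-! ## §0 The stub, verbatim -/

/-- `stub_realCubic` (verbatim signature of the registered stub). -/
def StubRealCubic : Prop :=
  ∀ ε : ℝ, 0 < ε → ∃ C : ℝ, ∀ (W : WeierstrassCurve ℚ) [W.IsElliptic] (K : Type) [Field K] [NumberField K],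
    Irreducible W.twoTorsionPolynomial.toPoly → Module.finrank ℚ K = 3 →
    (∃ θ : K, aeval θ W.twoTorsionPolynomial.toPoly = 0) → 0 < NumberField.discr K →
    (W.minimalDiscriminantNorm ℤ : ℝ) ≤ C * |(NumberField.discr K : ℝ)| * (W.conductorNorm ℤ : ℝ) ^ (6 + ε)

/-! ## §1 The reshaped objects -/

/-- Squarefree kernel `sqf(n) = ∏_{v_p(n) odd} p`. -/
def sqfree (n : ℕ) : ℕ := n.factorization.prod fun p k => p ^ (k % 2)

/-- Fundamental discriminant (Cohen Def. 5.1.2), in the literal shape of the tree's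
`isFundamentalDiscriminant_discr`. -/
def IsFundDiscr (D : ℤ) : Prop :=
  (D % 4 = 1 ∧ Squarefree D ∧ D ≠ 1) ∨ (4 ∣ D ∧ (D / 4 % 4 = 2 ∨ D / 4 % 4 = 3) ∧ Squarefree (D / 4))

/-- No prime is totally ramified in the (cubic) field `K`. -/
def NowhereTotallyRamified (K : Type*) [Field K] [NumberField K] : Prop :=
  ∀ (P : Ideal (𝓞 K)) [P.IsMaximal], P.ramificationIdx ℤ ≠ 3

/-- The sector: semistable away from `2` and `v₂(N) ≤ 1` (i.e. `N` squarefree). -/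
def Semistable (W : WeierstrassCurve ℚ) [W.IsElliptic] : Prop := Squarefree (W.conductorNorm ℤ)

/-- `2`-tameness of the cubic field: `2` is not totally ramified in `K` (automatic when `E` is
multiplicative or good ordinary at `2`; fails exactly for good supersingular reduction at `2`). -/
def TwoTame (K : Type*) [Field K] [NumberField K] : Prop :=
  ∀ (P : Ideal (𝓞 K)) [P.IsMaximal], (2 : 𝓞 K) ∈ P → P.ramificationIdx ℤ ≠ 3

/-- A `K`-free, `r`-free Szpiro inequality with the squarefree kernel as allowance, on a class `𝒞`. -/
def SqfSzpiroOn (𝒞 : ∀ (W : WeierstrassCurve ℚ) [W.IsElliptic], Prop) : Prop :=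
  ∀ ε : ℝ, 0 < ε → ∃ C : ℝ, ∀ (W : WeierstrassCurve ℚ) [W.IsElliptic], 𝒞 W →
    (W.minimalDiscriminantNorm ℤ : ℝ) ≤
      C * (sqfree (W.minimalDiscriminantNorm ℤ) : ℝ) * (W.conductorNorm ℤ : ℝ) ^ (6 + ε)

/-- The real class, `K`-free: irreducible `2`-division cubic with a totally real root field
(`⟺ 0 < d_K`, helper `R0`). -/
def ClassReal : ∀ (W : WeierstrassCurve ℚ) [W.IsElliptic], Prop := fun W _ =>
  Irreducible W.twoTorsionPolynomial.toPoly ∧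
    ∃ (K : Type) (_ : Field K) (_ : NumberField K), Module.finrank ℚ K = 3 ∧
      (∃ θ : K, aeval θ W.twoTorsionPolynomial.toPoly = 0) ∧ 0 < NumberField.discr K

/-- The real class cut down to the `2`-tame semistable sector. -/
def ClassRealSector : ∀ (W : WeierstrassCurve ℚ) [W.IsElliptic], Prop := fun W _ =>
  Irreducible W.twoTorsionPolynomial.toPoly ∧ Semistable W ∧
    ∃ (K : Type) (_ : Field K) (_ : NumberField K), Module.finrank ℚ K = 3 ∧
      (∃ θ : K, aeval θ W.twoTorsionPolynomial.toPoly = 0) ∧ 0 < NumberField.discr K ∧ TwoTame K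

/-! ## §2 Helper lemmas (statements; one prover cycle each) -/

/-- **R0 (S, sign).** `0 < d_K ↔ 0 < Δ`: `2⁸ Δ_W = I² d_K` (keystone, k1 G5) — the real stub is the
class `Δ > 0`. [cite: SilvermanAEC2009, III §1 (b-invariants, `Δ` of the 2-division cubic)] -/
theorem discr_pos_iff_Δ_pos (W : WeierstrassCurve ℚ) [W.IsElliptic] (K : Type) [Field K] [NumberField K]
    (hirr : Irreducible W.twoTorsionPolynomial.toPoly) (hK : Module.finrank ℚ K = 3)
    (hθ : ∃ θ : K, aeval θ W.twoTorsionPolynomial.toPoly = 0) :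
    0 < NumberField.discr K ↔ 0 < W.Δ := by
  sorry

/-- **R1 (M, pure ANT = Hasse 1930 with conductor `f = 1`).** In a Galois sextic `L/ℚ` with quadratic
subfield `K₂` and cubic subfield `F`: if no prime is totally ramified in `F` then `d_F = d_{K₂}`.
Route: `e(Q ∩ F) ≠ 3` ⟹ `Gal(L/K₂) ⊄ I(Q)` (contrapositive of the tree's `ramificationIdx_under_eq_three`)
⟹ `I(Q) ∩ Gal(L/K₂) = 1` (order-`3` subgroup) ⟹ `L/K₂` unramified at `Q` ⟹ tree
`discr_eq_discr_of_unramified`. [cite: Hasse1930, Math. Z. 31, `d(K₃) = d(K₂) f²`] -/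
theorem discr_eq_discr_of_nowhereTotallyRamified {L : Type*} [Field L] [NumberField L] [IsGalois ℚ L]
    (hL : finrank ℚ L = 6) (K₂ F : IntermediateField ℚ L) (hK₂ : finrank ℚ K₂ = 2)
    (hF : finrank ℚ F = 3) (h : ∀ (P : Ideal (𝓞 F)) [P.IsMaximal], P.ramificationIdx ℤ ≠ 3) :
    discr F = discr K₂ := by
  sorry

/-- **R1' (S/M, plumbing of R1 to an abstract cubic field).** A nowhere totally ramified cubic field has a
FUNDAMENTAL discriminant (`= d` of its quadratic resolvent `ℚ(√d_K)`; tree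
`isFundamentalDiscriminant_discr`).  (`¬ IsSquare d_K` is implied — a cyclic cubic field is totally
ramified at every ramified prime — but is kept as a hypothesis to keep the lemma one cycle.)
[cite: Hasse1930, Math. Z. 31] -/
theorem isFundDiscr_discr_of_nowhereTotallyRamified (K : Type) [Field K] [NumberField K]
    (hK : Module.finrank ℚ K = 3) (hsq : ¬ IsSquare (NumberField.discr K))
    (h : NowhereTotallyRamified K) : IsFundDiscr (NumberField.discr K) := by
  sorry

/-- **R1'' (S).** A nowhere totally ramified cubic field is not cyclic, i.e. `d_K` is not a square: a Galois
cubic has `e ∣ 3` at every prime (k2 G9 `ramificationIdx_dvd_three_of_isGalois`, proved there), so `e = 1`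
everywhere and `|d_K| = 1`, contradicting Minkowski (`NumberField.abs_discr_gt_two`); Galois ⟺ square
discriminant is the tree's `isGalois_iff_isSquare_discr_cubic`. [cite: Cohen1993, §6.4.5] -/
theorem not_isSquare_discr_of_nowhereTotallyRamified (K : Type) [Field K] [NumberField K]
    (hK : Module.finrank ℚ K = 3) (h : NowhereTotallyRamified K) : ¬ IsSquare (NumberField.discr K) := by
  sorry

/-- **R2 (S/M, the elliptic input on the sector).** If `K` embeds in `ℚ(E[2])`, `N` is squarefree and
`2` is not totally ramified in `K`, then NO prime is totally ramified in `K`: odd `p ∤ N` is unramified in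
`ℚ(E[2])` (tree `ramificationIdx_divisionField_self_eq_one_of_hasGoodReductionAt`), odd `p ∥ N` has
`e ∣ 2` in `ℚ(E[2])` (Tate curve at level `2`, tree
`ramificationIdx_divisionField_self_dvd_level_of_hasMultiplicativeReductionAt`), and `e` is multiplicative
in the tower `ℚ ⊂ K ⊂ ℚ(E[2])`. [cite: SilvermanAEC2009, Thm. VII.7.1; SilvermanATAEC1994, V.5] -/
theorem nowhereTotallyRamified_of_semistable (W : WeierstrassCurve ℚ) [W.IsElliptic]
    (K : Type) [Field K] [NumberField K] (hK : Module.finrank ℚ K = 3) (ψ : K →+* W.divisionField 2)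
    (hN : Semistable W) (h2 : TwoTame K) : NowhereTotallyRamified K := by
  sorry

/-- **R3 (M, `2`-adic supplement; Literature-grade).** Multiplicative reduction at `2` ⟹ `2` is not totally
ramified in `K` (`ℚ₂(E[2]) = ℚ₂(√γ, √q)`, so `e ∣ 2`; the tree's level-`n` lemma excludes `p ∣ n`, so this
is the missing `p = ℓ = 2` case).  Good ORDINARY reduction at `2` gives the same conclusion (Serre 1972
§1.11: Borel image); good SUPERSINGULAR reduction at `2` is the only escape (`e = 3`, `2` inert in `ℚ(√Δ)`).
[cite: SilvermanATAEC1994, V.5 (Tate curve, Exercise 5.11)] [cite: Serre1972, §1.11–1.12] -/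
theorem twoTame_of_multiplicative_at_two (W : WeierstrassCurve ℚ) [W.IsElliptic]
    (K : Type) [Field K] [NumberField K] (hK : Module.finrank ℚ K = 3) (ψ : K →+* W.divisionField 2)
    (h2 : (W.conductorNorm ℤ).factorization 2 = 1) : TwoTame K := by
  sorry

/-- **R4 (M, the residue theorem = the content of `r = 0`; class field theory).** In a totally real Galois
sextic `L/ℚ` with quadratic subfield `K₂` and cubic subfield `F` with `d_F = d_{K₂}` (R1), `L/K₂` is a cyclic
cubic extension unramified at all places, so `3 ∣ h(K₂)` (tree: Hasse `isUnramifiedAt_of_discr_eq_discr` +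
`HilbertClassFieldMaximal.dvd_classNumber_of_abelian_of_finrank_eq`; the plumbing `L ↪ K₂^alg` is the work).
[cite: Hasse1930, Math. Z. 31] [cite: Cox2013, §5.C Cor. 5.24] -/
theorem three_dvd_classNumber_of_discr_eq_discr {L : Type*} [Field L] [NumberField L] [IsGalois ℚ L]
    [IsTotallyReal L] (hL : finrank ℚ L = 6) (K₂ F : IntermediateField ℚ L) (hK₂ : finrank ℚ K₂ = 2)
    (hF : finrank ℚ F = 3) (hd : discr F = discr K₂) : 3 ∣ NumberField.classNumber K₂ := by
  sorry

/-- **R4E (M, plumbing of R1+R2+R4 to the curve): the EXACT content of `r = 0` on the `2`-tame semistable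
sector** — the quadratic resolvent `ℚ(√Δ)` has class number divisible by `3`.  (Brumer–Kramer: for
semistable `E` without rational `2`-torsion, `ℚ(E[2]) / ℚ(√Δ)` is unramified unless `E` is supersingular at
`2`.) [cite: BrumerKramer1977, §5] [corpus: book:david1995-number-theory-paris-19923 p.64 (N. Boston)] -/
def ResidueR0 : Prop :=
  ∀ (W : WeierstrassCurve ℚ) [W.IsElliptic] (K : Type) [Field K] [NumberField K],
    Irreducible W.twoTorsionPolynomial.toPoly → Module.finrank ℚ K = 3 →
    (∃ θ : K, aeval θ W.twoTorsionPolynomial.toPoly = 0) → 0 < NumberField.discr K →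
    Semistable W → TwoTame K →
    ∀ (K₂ : Type) [Field K₂] [NumberField K₂], Module.finrank ℚ K₂ = 2 →
      (∃ η : K₂, η ^ 2 = algebraMap ℚ K₂ W.Δ) → 3 ∣ NumberField.classNumber K₂

theorem residueR0_holds : ResidueR0 := by
  sorry

/-- **R5 (S, lower keystone — on pages k1 G5 K6 / k3 G8, restated with `sqfree`).** `sqf(Δ_min) ∣ d_K`
(parity: `2⁸ Δ = I² d_K`, and `Δ = u¹² Δ_min`). -/
def AllowLowerSqf : Prop :=
  ∀ (W : WeierstrassCurve ℚ) [W.IsElliptic] (K : Type) [Field K] [NumberField K],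
    Irreducible W.twoTorsionPolynomial.toPoly → Module.finrank ℚ K = 3 →
    (∃ θ : K, aeval θ W.twoTorsionPolynomial.toPoly = 0) →
    sqfree (W.minimalDiscriminantNorm ℤ) ∣ (NumberField.discr K).natAbs

/-- **R6 (S given R1'+R2, upper allowance on the sector).** `|d_K| ∣ 4 · sqf(Δ_min)`: `d_K` is fundamental
with squarefree kernel `± sqf(Δ_min)` (R1', R2, parity R5). Census j345229 (this page). -/
def SectorUpperSqf : Prop :=
  ∀ (W : WeierstrassCurve ℚ) [W.IsElliptic] (K : Type) [Field K] [NumberField K],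
    Irreducible W.twoTorsionPolynomial.toPoly → Module.finrank ℚ K = 3 →
    (∃ θ : K, aeval θ W.twoTorsionPolynomial.toPoly = 0) → Semistable W → TwoTame K →
    (NumberField.discr K).natAbs ∣ 4 * sqfree (W.minimalDiscriminantNorm ℤ)

theorem sectorUpperSqf_of
    (h0 : ∀ (K : Type) [Field K] [NumberField K], Module.finrank ℚ K = 3 →
      NowhereTotallyRamified K → ¬ IsSquare (NumberField.discr K))
    (h1 : ∀ (K : Type) [Field K] [NumberField K], Module.finrank ℚ K = 3 →
      ¬ IsSquare (NumberField.discr K) → NowhereTotallyRamified K → IsFundDiscr (NumberField.discr K))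
    (h2 : ∀ (W : WeierstrassCurve ℚ) [W.IsElliptic] (K : Type) [Field K] [NumberField K],
      Module.finrank ℚ K = 3 → (K →+* W.divisionField 2) → Semistable W → TwoTame K →
      NowhereTotallyRamified K)
    (h5 : AllowLowerSqf) : SectorUpperSqf := by
  sorry

/-! ## §3 Assembly sketch: the sandwich `SqfSzpiroOn ClassReal ⟹ stub ⟹ SqfSzpiroOn ClassRealSector` -/

private theorem sqfree_pos (n : ℕ) : 0 < sqfree n := by
  unfold sqfree
  rw [Finsupp.prod]
  refine Finset.prod_pos fun p hp => pow_pos ?_ _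
  have hp' : p ∈ n.primeFactors := by rwa [Nat.support_factorization] at hp
  exact (Nat.prime_of_mem_primeFactors hp').pos

private theorem scale_const (C s N : ℝ) (hs : 0 ≤ s) (hN : 0 ≤ N) :
    C * s * N ≤ max C 0 * s * N :=
  mul_le_mul_of_nonneg_right (mul_le_mul_of_nonneg_right (le_max_left C 0) hs) hN

private theorem scale_allow (C s d N : ℝ) (hle : s ≤ d) (hN : 0 ≤ N) :
    max C 0 * s * N ≤ max C 0 * d * N :=
  mul_le_mul_of_nonneg_right (mul_le_mul_of_nonneg_left hle (le_max_right C 0)) hN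

private theorem scale_allow_four (C d s N : ℝ) (hle : d ≤ 4 * s) (hN : 0 ≤ N) :
    max C 0 * d * N ≤ 4 * max C 0 * s * N := by
  have h := mul_le_mul_of_nonneg_right (mul_le_mul_of_nonneg_left hle (le_max_right C 0)) hN
  calc max C 0 * d * N ≤ max C 0 * (4 * s) * N := h
    _ = 4 * max C 0 * s * N := by ring

/-- **Glue 1 (PROVED modulo R5): the `K`-free inequality implies the stub** (`sqf(Δ_min) ≤ |d_K|`). -/
theorem stub_of_sqfSzpiro (h5 : AllowLowerSqf) (h : SqfSzpiroOn ClassReal) : StubRealCubic := by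
  intro ε hε
  obtain ⟨C, hC⟩ := h ε hε
  refine ⟨max C 0, fun W _ K _ _ hirr hK hθ hd => ?_⟩
  have hcls : ClassReal W := ⟨hirr, K, inferInstance, inferInstance, hK, hθ, hd⟩
  have h1 := hC W hcls
  have hdvd := h5 W K hirr hK hθ
  have hd0 : (NumberField.discr K).natAbs ≠ 0 := Int.natAbs_ne_zero.mpr (NumberField.discr_ne_zero K)
  have hle : (sqfree (W.minimalDiscriminantNorm ℤ) : ℝ) ≤ |(NumberField.discr K : ℝ)| := by
    have := Nat.le_of_dvd (Nat.pos_of_ne_zero hd0) hdvd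
    rw [← Int.cast_abs, ← Nat.cast_natAbs]
    exact_mod_cast this
  have hN : (0 : ℝ) ≤ (W.conductorNorm ℤ : ℝ) ^ (6 + ε) := by positivity
  have hs : (0 : ℝ) ≤ (sqfree (W.minimalDiscriminantNorm ℤ) : ℝ) := by positivity
  exact h1.trans ((scale_const C _ _ hs hN).trans (scale_allow C _ _ _ hle hN))

/-- **Glue 2 (PROVED modulo R6): on the `2`-tame semistable sector the stub IS the `K`-free inequality**
(constant `4C`). -/
theorem sqfSzpiroOn_sector_of_stub (h6 : SectorUpperSqf) (h : StubRealCubic) :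
    SqfSzpiroOn ClassRealSector := by
  intro ε hε
  obtain ⟨C, hC⟩ := h ε hε
  refine ⟨4 * max C 0, fun W _ hcls => ?_⟩
  obtain ⟨hirr, hss, K, _, _, hK, hθ, hd, h2⟩ := hcls
  have h1 := hC W K hirr hK hθ hd
  have hdvd := h6 W K hirr hK hθ hss h2
  have hle : |(NumberField.discr K : ℝ)| ≤ 4 * (sqfree (W.minimalDiscriminantNorm ℤ) : ℝ) := by
    have h4 : 0 < 4 * sqfree (W.minimalDiscriminantNorm ℤ) :=
      Nat.mul_pos (by norm_num) (sqfree_pos _)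
    have := Nat.le_of_dvd h4 hdvd
    rw [← Int.cast_abs, ← Nat.cast_natAbs]
    exact_mod_cast this
  have hN : (0 : ℝ) ≤ (W.conductorNorm ℤ : ℝ) ^ (6 + ε) := by positivity
  have hd' : (0 : ℝ) ≤ |(NumberField.discr K : ℝ)| := abs_nonneg _
  exact h1.trans ((scale_const C _ _ hd' hN).trans (scale_allow_four C _ _ _ hle hN))

/-- **Link to the route (by name).** The verbatim stub is the real half of the crux decl. -/
theorem indexSzpiro_real_half (h : IndexSzpiro) : StubRealCubic := by
  intro ε hε
  obtain ⟨C, hC⟩ := h ε hε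
  exact ⟨C, fun W _ K _ _ hirr hK hθ _ => hC W K hirr hK hθ⟩

end Summit.ABC.ABC.Cruxes.IndexSzpiro.StubIdeas2RealG10

end
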